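import Summits.QuantumFields.YangMills.Theorems.BalabanUVNodesPortS1ChartJacobianRecord

/-!
# NODE O port PT-A — socket (o2) = brick (h2), FULL MEASURE: «we express the Haar measure dU′ as dU′ = σ(A′)dA′» ([16] p.260) GLOBALLY — the Pauli chart at ANY centre covers `SU(2)` up to a
# Haar-null set (`dU({exp(iA)·u : |A| < π}) = 1`), hence for EVERY measurable integrand and EVERY background `V^{(k)}` the whole (2.1)-type integral IS the chart integral of [I] (2.10):
# `∫ G dV = σ₀^{#T_k} · ∫_{|x_b| < π ∀ b} G(pert V^{(k)} x) · Π_b chartJac(x_b) dx` — NO support hypothesis (the (2.9) cut-off then shrinks the FLAT domain, by ✓`…PortS1FluctChart` (25))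

Cell `ym-nodeO-ideate`, porter seat `ymgap-nodeO-port-PTA-1` (gen 9); `--kind proof --supports stmt-QuantumFields-27930 --as helper`; sequel of ✓`…PortS1ChartJacobian{,Pi,Record}` (window identities for `s ≤ π`).
[I] = [Balaban1987RG1] (2.4) p.266, (2.10) p.267; [16] = [Balaban1985UV3] (18) p.260.

CONTENT (theorems only): §1 one bond — `sigmaMeasure_ball_pi` (`σdA(B_π) = 1`), ★ `haar_image_chartAt_ball_pi` (`dU(exp(iB_π)·u) = 1`), `haar_compl_image_chartAt_ball_pi` (`= 0`), `haar_restrict_image_chartAt_ball_pi`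
(`dU|_{window_π} = dU`); §2 many bonds — `compl_pi_subset_iUnion`, ★ `pi_haar_compl_window_pi` (`(⊗dU)(window_πᶜ) = 0`), `pi_haar_restrict_window_pi`, ★★★ `pi_haar_eq_chart` (MEASURE FORM: `⊗_b dU(b) = σ₀^{#ι} •
(chartPi U₀)_*(σ · dA|_{B_π^ι})`), ★★★ `lintegral_pi_haar_eq_chart`, ★★ `integral_pi_haar_eq_chart`; §3 at the record — `fieldMeasure_compl_window_pi`, `fieldMeasure_restrict_window_pi`, ★★★ `fieldMeasure_eq_chart` (`dV = σ₀^{#T_k} • (pert V^{(k)})_*(σ · dx|_{flat window_π})`), ★★★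
`lintegral_fieldMeasure_eq_chart`, ★★ `integral_fieldMeasure_eq_chart` (Bochner, every a.e.-strongly measurable `f`).

HONEST FRAMING.  Measure-theoretic bookkeeping (a probability-one window) over the landed window identities; NOTHING of Bałaban's renormalization-group estimates asserted, ported or discharged; (o1) `D̃` ∕ (o3) ∕ (o4)
NOT here; `stub_P0C` ∕ `stub_FE` OPEN; ⟨27930⟩ ⁸-Ax-LR4 OPEN · no claim; NODE O 0∕1; COUNT 8∕28 · K 1∕4 UNMOVED; finite `𝕋⁴_{L^K}` at fixed ε — NOT continuum ∕ OS ∕ Clay; **the Yang–Mills mass gap is NOT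
proved by any of this.**  No `sorry`, no `def`, no `instance`, no `notation`; standard axioms.
-/

noncomputable section

open MeasureTheory MeasureTheory.Measure Set Metric
open scoped ENNReal BigOperators

namespace Summit.QuantumFields.YangMills.Theorems.BalabanUVNodesPortS1

open Literature.MathematicalPhysics.QuantumFieldTheory (haarProbability)
open Literature.MathematicalPhysics.QuantumFieldTheory.Balaban1983to89
open Literature.MathematicalPhysics.QuantumFieldTheory.Balaban1983to89.Node00
open Literature.MathematicalPhysics.QuantumFieldTheory.Balaban1983to89.T4Continuum (T4Family)
open Literature.MathematicalPhysics.QuantumFieldTheory.Balaban1983to89.B10Eq22Rescaling (sigmaSU2 sigmaSU2_zero)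
open Literature.MathematicalPhysics.QuantumFieldTheory.Balaban1983to89.B10Eq18SigmaSU2Haar
open Summit.QuantumFields.YangMills.Theorems.K0RecordFormatNames (FluctIdx pert)

/-! ## §1  ONE BOND: the chart window of radius `π` has Haar probability one -/

section OneBond

/-- `σ(A)dA` gives mass `0` to the complement of the injectivity ball (it is carried by it). [cite: Balaban1985UV3, (18) p.260] -/
theorem sigmaMeasure_compl_ball_pi : sigmaMeasure (ball (0 : EuclideanSpace ℝ (Fin 3)) Real.pi)ᶜ = 0 := by
  rw [sigmaMeasure, withDensity_apply _ measurableSet_ball.compl, Measure.restrict_restrict measurableSet_ball.compl, compl_inter_self,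
    Measure.restrict_empty, lintegral_zero_measure]

/-- `σ(A)dA(B_π) = 1`: print's density integrates to one over the injectivity ball. [cite: Balaban1985UV3, (18) p.260] -/
theorem sigmaMeasure_ball_pi : sigmaMeasure (ball (0 : EuclideanSpace ℝ (Fin 3)) Real.pi) = 1 := by
  haveI : IsProbabilityMeasure sigmaMeasure := isProbabilityMeasure_sigmaMeasure
  exact (prob_compl_eq_zero_iff measurableSet_ball).1 sigmaMeasure_compl_ball_pi

/-- ★ **THE CHART WINDOW OF RADIUS `π` AT ANY CENTRE HAS HAAR PROBABILITY ONE**: `dU({exp(iA)·u : |A| < π}) = 1`. [cite: Balaban1985UV3, (18) p.260] [cite: Balaban1987RG1, (2.4) p.266] -/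
theorem haar_image_chartAt_ball_pi (u : Matrix.specialUnitaryGroup (Fin 2) ℂ) :
    haarProbability (Matrix.specialUnitaryGroup (Fin 2) ℂ) (chartAt u '' ball (0 : EuclideanSpace ℝ (Fin 3)) Real.pi) = 1 := by
  have h := congrArg (fun μ : Measure (Matrix.specialUnitaryGroup (Fin 2) ℂ) => μ univ) (haar_restrict_chartAt_image u le_rfl)
  simp only [Measure.restrict_apply_univ, Measure.map_apply (measurable_chartAt u) MeasurableSet.univ, preimage_univ] at h
  rw [h, sigmaMeasure_ball_pi]

/-- Its complement is Haar-null. [cite: Balaban1985UV3, (18) p.260] -/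
theorem haar_compl_image_chartAt_ball_pi (u : Matrix.specialUnitaryGroup (Fin 2) ℂ) :
    haarProbability (Matrix.specialUnitaryGroup (Fin 2) ℂ) (chartAt u '' ball (0 : EuclideanSpace ℝ (Fin 3)) Real.pi)ᶜ = 0 :=
  (prob_compl_eq_zero_iff (measurableSet_image_chartAt u measurableSet_ball Subset.rfl)).2 (haar_image_chartAt_ball_pi u)

/-- Restricting Haar measure to the radius-`π` window changes nothing. [cite: Balaban1985UV3, (18) p.260] -/
theorem haar_restrict_image_chartAt_ball_pi (u : Matrix.specialUnitaryGroup (Fin 2) ℂ) :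
    (haarProbability (Matrix.specialUnitaryGroup (Fin 2) ℂ)).restrict (chartAt u '' ball (0 : EuclideanSpace ℝ (Fin 3)) Real.pi) =
      haarProbability (Matrix.specialUnitaryGroup (Fin 2) ℂ) :=
  Measure.restrict_eq_self_of_ae_mem (by rw [ae_iff]; exact haar_compl_image_chartAt_ball_pi u)

end OneBond

/-! ## §2  MANY BONDS: the product window of radius `π` has full product measure; `⊗_b dU(b)` IS the chart law -/

section ManyBonds

variable {ι : Type*}

/-- The complement of a product set lies in the union of the coordinate complements. [folklore] -/
theorem compl_pi_subset_iUnion {α : Type*} (W : ι → Set α) : (Set.pi univ W)ᶜ ⊆ ⋃ b, Function.eval b ⁻¹' (W b)ᶜ := by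
  intro f hf
  simp only [mem_compl_iff, mem_univ_pi, not_forall] at hf
  obtain ⟨b, hb⟩ := hf
  exact mem_iUnion.2 ⟨b, hb⟩

variable [Fintype ι]

/-- ★ **THE PRODUCT WINDOW OF RADIUS `π` IS CONULL** for `⊗_b dU(b)`, at every centre `U₀`. [cite: Balaban1985UV3, (13) p.259, (18) p.260] -/
theorem pi_haar_compl_window_pi (U₀ : ι → Matrix.specialUnitaryGroup (Fin 2) ℂ) :
    (Measure.pi fun _ : ι => haarProbability (Matrix.specialUnitaryGroup (Fin 2) ℂ))
      (Set.pi univ fun b => chartAt (U₀ b) '' ball (0 : EuclideanSpace ℝ (Fin 3)) Real.pi)ᶜ = 0 := by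
  classical
  refine measure_mono_null (compl_pi_subset_iUnion _) ((measure_iUnion_null_iff).2 fun b => ?_)
  exact Measure.pi_eval_preimage_null _ (haar_compl_image_chartAt_ball_pi (U₀ b))

/-- Restricting `⊗_b dU(b)` to the radius-`π` product window changes nothing. [cite: Balaban1985UV3, (18) p.260] -/
theorem pi_haar_restrict_window_pi (U₀ : ι → Matrix.specialUnitaryGroup (Fin 2) ℂ) :
    (Measure.pi fun _ : ι => haarProbability (Matrix.specialUnitaryGroup (Fin 2) ℂ)).restrict
        (Set.pi univ fun b => chartAt (U₀ b) '' ball (0 : EuclideanSpace ℝ (Fin 3)) Real.pi) =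
      Measure.pi fun _ : ι => haarProbability (Matrix.specialUnitaryGroup (Fin 2) ℂ) :=
  Measure.restrict_eq_self_of_ae_mem (by rw [ae_iff]; exact pi_haar_compl_window_pi U₀)

/-- ★★★ **`⊗_b dU(b)` IS THE CHART LAW** at every centre: `⊗_b dU(b) = σ₀^{#ι} • (A ↦ (exp(iA_b)·U₀(b))_b)_*((Π_b chartJac(A_b)) · dA|_{|A_b| < π ∀ b})`. [cite: Balaban1987RG1, (2.4) p.266, (2.10) p.267]
[cite: Balaban1985UV3, (18) p.260] -/
theorem pi_haar_eq_chart (U₀ : ι → Matrix.specialUnitaryGroup (Fin 2) ℂ) :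
    (Measure.pi fun _ : ι => haarProbability (Matrix.specialUnitaryGroup (Fin 2) ℂ)) =
      ENNReal.ofReal (sigmaSU2 0) ^ Fintype.card ι •
        (((volume : Measure (ι → EuclideanSpace ℝ (Fin 3))).restrict (Set.pi univ fun _ => ball (0 : EuclideanSpace ℝ (Fin 3)) Real.pi)).withDensity
          fun A => ENNReal.ofReal (fluctSigma A)).map (chartPi U₀) := by
  rw [← pi_haar_restrict_window_pi U₀, pi_haar_restrict_chartPi_image U₀ le_rfl]

/-- ★★★ **EVERY INTEGRAL AGAINST `⊗_b dU(b)` IS A CHART INTEGRAL**: for measurable `G ≥ 0` and any centre `U₀`,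
`∫ G d(⊗_b dU(b)) = σ₀^{#ι} · ∫_{|A_b|<π ∀ b} G((exp(iA_b)·U₀(b))_b) · Π_b chartJac(A_b) dA`. [cite: Balaban1987RG1, (2.10) p.267] [cite: Balaban1985UV3, (13) p.259, (18) p.260] -/
theorem lintegral_pi_haar_eq_chart (U₀ : ι → Matrix.specialUnitaryGroup (Fin 2) ℂ) (G : (ι → Matrix.specialUnitaryGroup (Fin 2) ℂ) → ℝ≥0∞) (hG : Measurable G) :
    ∫⁻ U, G U ∂(Measure.pi fun _ : ι => haarProbability (Matrix.specialUnitaryGroup (Fin 2) ℂ)) =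
      ENNReal.ofReal (sigmaSU2 0) ^ Fintype.card ι *
        ∫⁻ A in Set.pi univ (fun _ => ball (0 : EuclideanSpace ℝ (Fin 3)) Real.pi), G (chartPi U₀ A) * ENNReal.ofReal (fluctSigma A) := by
  rw [← setLIntegral_pi_haar_chartPi_image U₀ le_rfl G hG, pi_haar_restrict_window_pi]

/-- ★★ BOCHNER FORM: for `f` a.e.-strongly measurable w.r.t. `⊗_b dU(b)` (real Banach values) and any centre `U₀`,
`∫ f d(⊗_b dU(b)) = σ₀^{#ι} · ∫_{|A_b|<π ∀ b} σ(A) • f((exp(iA_b)·U₀(b))_b) dA`. [cite: Balaban1987RG1, (2.10) p.267] [cite: Balaban1985UV3, (18) p.260] -/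
theorem integral_pi_haar_eq_chart {G : Type*} [NormedAddCommGroup G] [NormedSpace ℝ G] (U₀ : ι → Matrix.specialUnitaryGroup (Fin 2) ℂ)
    (f : (ι → Matrix.specialUnitaryGroup (Fin 2) ℂ) → G) (hf : AEStronglyMeasurable f (Measure.pi fun _ : ι => haarProbability (Matrix.specialUnitaryGroup (Fin 2) ℂ))) :
    ∫ U, f U ∂(Measure.pi fun _ : ι => haarProbability (Matrix.specialUnitaryGroup (Fin 2) ℂ)) =
      (sigmaSU2 0) ^ Fintype.card ι • ∫ A in Set.pi univ (fun _ => ball (0 : EuclideanSpace ℝ (Fin 3)) Real.pi), fluctSigma A • f (chartPi U₀ A) := by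
  rw [← pi_haar_restrict_window_pi U₀] at hf
  rw [← setIntegral_pi_haar_chartPi_image U₀ le_rfl f hf, pi_haar_restrict_window_pi]

end ManyBonds

/-! ## §3  AT THE RECORD: `dV = σ₀^{#T_k} σ(B′) dB′` through `V = exp(iB′)·V^{(k)}`, for EVERY integrand -/

section Record

variable (F : T4Family)

/-- The radius-`π` window around any background is conull for `dV`. [cite: Balaban1987RG1, (2.4) p.266] [cite: Balaban1985UV3, (18) p.260] -/
theorem fieldMeasure_compl_window_pi (K k : ℕ) (Vk : GaugeField (F.P K) k (SU 2)) :
    fieldMeasure (F.P K) k (SU 2) (Set.pi univ fun b : PBond (F.P K) k => chartAt (Vk b) '' ball (0 : EuclideanSpace ℝ (Fin 3)) Real.pi)ᶜ = 0 :=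
  pi_haar_compl_window_pi (ι := PBond (F.P K) k) Vk

/-- Restricting `dV` to the radius-`π` window around any background changes nothing. [cite: Balaban1987RG1, (2.4) p.266] [cite: Balaban1985UV3, (18) p.260] -/
theorem fieldMeasure_restrict_window_pi (K k : ℕ) (Vk : GaugeField (F.P K) k (SU 2)) :
    (fieldMeasure (F.P K) k (SU 2)).restrict (Set.pi univ fun b : PBond (F.P K) k => chartAt (Vk b) '' ball (0 : EuclideanSpace ℝ (Fin 3)) Real.pi) =
      fieldMeasure (F.P K) k (SU 2) :=
  Measure.restrict_eq_self_of_ae_mem (by rw [ae_iff]; exact fieldMeasure_compl_window_pi F K k Vk)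

/-- ★★★ **`dV` IS THE CHART LAW IN DEF-1's COORDINATES, at every background**: `dV = σ₀^{#T_k} • (pert V^{(k)})_*((Π_b chartJac(x_b)) · dx|_{{x : √(Σ_a x(b,a)²) < π ∀ b}})`.
[cite: Balaban1987RG1, (2.4) p.266, (2.10) p.267] [cite: Balaban1985UV3, (18) p.260] -/
theorem fieldMeasure_eq_chart (K k : ℕ) (Vk : GaugeField (F.P K) k (SU 2)) :
    fieldMeasure (F.P K) k (SU 2) =
      ENNReal.ofReal (sigmaSU2 0) ^ Fintype.card (PBond (F.P K) k) •
        (((volume : Measure (FluctIdx F k K → ℝ)).restrict {x | ∀ b : PBond (F.P K) k, √(∑ a : Fin 3, x (b, a) ^ 2) < Real.pi}).withDensity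
          fun x => ENNReal.ofReal (fluctSigma (fluctVec F k K x))).map (pert F k K Vk) := by
  have key := fieldMeasure_restrict_window_eq F K k Vk le_rfl
  rw [fieldMeasure_restrict_window_pi] at key
  exact key

/-- ★★★ **THE (2.1) INTEGRAL IS THE (2.10) CHART INTEGRAL, EVERY MEASURABLE INTEGRAND, EVERY BACKGROUND**:
`∫ G dV = σ₀^{#T_k} · ∫_{{x : √(Σ_a x(b,a)²) < π ∀ b}} G(pert F k K Vk x) · Π_b chartJac(x_b) dx`. [cite: Balaban1987RG1, (2.10) p.267] [cite: Balaban1985UV3, (13) p.259, (18) p.260] -/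
theorem lintegral_fieldMeasure_eq_chart (K k : ℕ) (Vk : GaugeField (F.P K) k (SU 2)) (G : GaugeField (F.P K) k (SU 2) → ℝ≥0∞) (hG : Measurable G) :
    ∫⁻ V, G V ∂(fieldMeasure (F.P K) k (SU 2)) =
      ENNReal.ofReal (sigmaSU2 0) ^ Fintype.card (PBond (F.P K) k) *
        ∫⁻ x in {x | ∀ b : PBond (F.P K) k, √(∑ a : Fin 3, x (b, a) ^ 2) < Real.pi}, G (pert F k K Vk x) * ENNReal.ofReal (fluctSigma (fluctVec F k K x)) := by
  have key := setLIntegral_fieldMeasure_pert_window F K k Vk le_rfl G hG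
  rw [fieldMeasure_restrict_window_pi] at key
  exact key

/-- ★★ **BOCHNER FORM AT THE RECORD**: for `f` a.e.-strongly measurable w.r.t. `dV` (real Banach values) and every background `Vk`,
`∫ f dV = σ₀^{#T_k} · ∫_{flat window_π} σ(fluctVec x) • f(pert F k K Vk x) dx`. [cite: Balaban1987RG1, (2.10) p.267] [cite: Balaban1985UV3, (18) p.260] -/
theorem integral_fieldMeasure_eq_chart {G : Type*} [NormedAddCommGroup G] [NormedSpace ℝ G] (K k : ℕ) (Vk : GaugeField (F.P K) k (SU 2))
    (f : GaugeField (F.P K) k (SU 2) → G) (hf : AEStronglyMeasurable f (fieldMeasure (F.P K) k (SU 2))) :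
    ∫ V, f V ∂(fieldMeasure (F.P K) k (SU 2)) =
      (sigmaSU2 0) ^ Fintype.card (PBond (F.P K) k) •
        ∫ x in {x | ∀ b : PBond (F.P K) k, √(∑ a : Fin 3, x (b, a) ^ 2) < Real.pi}, fluctSigma (fluctVec F k K x) • f (pert F k K Vk x) := by
  have hf' : AEStronglyMeasurable f ((fieldMeasure (F.P K) k (SU 2)).restrict
      (Set.pi univ fun b : PBond (F.P K) k => chartAt (Vk b) '' ball (0 : EuclideanSpace ℝ (Fin 3)) Real.pi)) := by
    rw [fieldMeasure_restrict_window_pi]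
    exact hf
  have key := setIntegral_fieldMeasure_pert_window F K k Vk le_rfl f hf'
  rw [fieldMeasure_restrict_window_pi] at key
  exact key

end Record

end Summit.QuantumFields.YangMills.Theorems.BalabanUVNodesPortS1

end
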